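import Summits.QuantumFields.QCD.Theses.SpectralDefectExtinction
import Summits.QuantumFields.QCD.Theorems.SpectralDefectExtinctionWindowExtinctionStubNegCountMeasurable
import Summits.QuantumFields.QCD.Theorems.SpectralDefectExtinctionTipPricingStubExtinctOfDOS
import Literature.MathematicalPhysics.QuantumFieldTheory.LatticeGaugeProofs
import Literature.MathematicalPhysics.QuantumFieldTheory.QCDPhaseQuenched

/-!
# Stub `stub_tightOfMoments` of line `tight-from-two-moments`
(crux `Summit.QuantumFields.QCD.Theses.SpectralDefectExtinction.TipPricing`,
item stmt-QuantumFields-8967)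

**What is proved.** The registered stub `stub_tightOfMoments` (the Hölder `(3/2, 3)` step of the
line): on the torus of side `L` at coupling `β`, with the phase-quenched weight
`w(U) = ∏_f |det D_W(U, mq_f, 1)| ≥ 0`, the index-type observable
`q(U) = #{roots z of charpoly(Γ₅ D_W(U, m₀, 1)) with re z < 0} − n₀` and the Wilson probability
measure `μ`: if `Z = ∫ w dμ > 0`, `B = ∫ q² w dμ > 0` and `(∫ q⁴ w)(∫ w)² ≤ (∫ q² w)³`, then
`1 ≤ ∫ |q| w dμ / ∫ w dμ`.

**Proof.** Pure measure theory (`tightOfMoments_core`).  With `A = ∫ |q| w`, `T = ∫ |q|³ w`,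
`K = ∫ q⁴ w`, the weighted Cauchy–Schwarz inequality (`tightOfMoments_cauchySchwarz`, proved by
the discriminant of the nonnegative quadratic form `t ↦ ∫ (f − t g)² v`) gives `B² ≤ A T`
(weight `|q| w`, functions `1`, `|q|`) and `T² ≤ B K` (weight `w`, functions `|q|`, `q²`); hence
`B⁴ ≤ A² T² ≤ A² B K`, so `B³ ≤ A² K` (`B > 0`), in particular `K > 0`; with the hypothesis
`K Z² ≤ B³` this is `K Z² ≤ K A²`, i.e. `Z ≤ A`.  All integrands `|q|^j w` are integrable: `q` is
measurable (`stub_negCountMeasurable`, landed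
`Theorems/SpectralDefectExtinctionWindowExtinctionStubNegCountMeasurable.lean`) and bounded
(`extinctOfDOS_countP_le`: a root count never exceeds the dimension), `w` is continuous and
bounded (`extinctOfDOS_weight`, both landed in
`Theorems/SpectralDefectExtinctionTipPricingStubExtinctOfDOS.lean`), and the Wilson measure is a
probability measure (`isProbabilityMeasure_wilsonMeasure`).  No named facts are used.
-/

noncomputable section

namespace Summit.QuantumFields.QCD.Cruxes.TipPricing.TightFromTwoMoments

open scoped BigOperators Topology Classical
open MeasureTheory Filter
open Literature.MathematicalPhysics.QuantumLattice Literature.MathematicalPhysics.QuantumFieldTheory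
  Literature.Probability.LatticeModels
open Summit.QuantumFields.QCD.Theses.SpectralDefectExtinction
open Summit.QuantumFields.QCD.Cruxes.TipPricing.HermitianFlowCoarea
open Summit.QuantumFields.QCD.Cruxes.WindowExtinction.FreeVolumeHeavyWitness

/-! ## Measure-theoretic helpers -/

/-- **Weighted Cauchy–Schwarz.** For a pointwise nonnegative weight `v` and real functions `f, g`
with `f² v`, `g² v`, `f g v` integrable (presented as `F`, `G`, `P`):
`(∫ f g v)² ≤ (∫ f² v)(∫ g² v)`.  Proof: the quadratic form `t ↦ ∫ (f − t g)² v ≥ 0` has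
nonpositive discriminant. -/
theorem tightOfMoments_cauchySchwarz {X : Type*} [MeasurableSpace X] {μ : Measure X}
    (f g v : X → ℝ) {F G P : X → ℝ} (hv : ∀ x, 0 ≤ v x)
    (hF : ∀ x, F x = f x ^ 2 * v x) (hG : ∀ x, G x = g x ^ 2 * v x)
    (hP : ∀ x, P x = f x * g x * v x)
    (hFi : Integrable F μ) (hGi : Integrable G μ) (hPi : Integrable P μ) :
    (∫ x, P x ∂μ) ^ 2 ≤ (∫ x, F x ∂μ) * ∫ x, G x ∂μ := by
  have key : ∀ t : ℝ, 0 ≤ (∫ x, G x ∂μ) * (t * t) + (-2 * ∫ x, P x ∂μ) * t + ∫ x, F x ∂μ := by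
    intro t
    have h1 : ∫ x, (t * t * G x - 2 * t * P x + F x) ∂μ =
        t * t * (∫ x, G x ∂μ) - 2 * t * (∫ x, P x ∂μ) + ∫ x, F x ∂μ := by
      rw [integral_add ((hGi.const_mul _).sub' (hPi.const_mul _)) hFi,
        integral_sub (hGi.const_mul _) (hPi.const_mul _), integral_const_mul, integral_const_mul]
    have h2 : 0 ≤ ∫ x, (t * t * G x - 2 * t * P x + F x) ∂μ := by
      refine integral_nonneg fun x => ?_
      show (0 : ℝ) ≤ t * t * G x - 2 * t * P x + F x
      have h3 : t * t * G x - 2 * t * P x + F x = (f x - t * g x) ^ 2 * v x := by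
        rw [hF, hG, hP]; ring
      rw [h3]
      exact mul_nonneg (sq_nonneg _) (hv x)
    rw [h1] at h2
    linarith
  have hd := discrim_le_zero key
  rw [discrim] at hd
  nlinarith [hd]

/-- **The Hölder `(3/2, 3)` step, abstract form.** For a weight `w ≥ 0` and a real observable `q`
with every `|q|^j w` integrable: `∫ w > 0`, `∫ q² w > 0` and `(∫ q⁴ w)(∫ w)² ≤ (∫ q² w)³` imply
`1 ≤ ∫ |q| w / ∫ w`. -/
theorem tightOfMoments_core {X : Type*} [MeasurableSpace X] {μ : Measure X} {q w : X → ℝ}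
    (hw0 : ∀ x, 0 ≤ w x) (hI : ∀ j : ℕ, Integrable (fun x => |q x| ^ j * w x) μ)
    (hZ : 0 < ∫ x, w x ∂μ) (hB : 0 < ∫ x, q x ^ 2 * w x ∂μ)
    (hC : (∫ x, q x ^ 4 * w x ∂μ) * (∫ x, w x ∂μ) ^ 2 ≤ (∫ x, q x ^ 2 * w x ∂μ) ^ 3) :
    1 ≤ (∫ x, |q x| * w x ∂μ) / ∫ x, w x ∂μ := by
  have hI1 : Integrable (fun x => |q x| * w x) μ := by simpa only [pow_one] using hI 1
  have hI2 : Integrable (fun x => q x ^ 2 * w x) μ := by simpa only [sq_abs] using hI 2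
  have hI4 : Integrable (fun x => q x ^ 4 * w x) μ := by
    simpa only [Even.pow_abs (by decide : Even 4)] using hI 4
  -- Cauchy–Schwarz twice
  have cs1 : (∫ x, q x ^ 2 * w x ∂μ) ^ 2 ≤ (∫ x, |q x| * w x ∂μ) * ∫ x, |q x| ^ 3 * w x ∂μ :=
    tightOfMoments_cauchySchwarz (fun _ => 1) (fun x => |q x|) (fun x => |q x| * w x)
      (fun x => mul_nonneg (abs_nonneg _) (hw0 x)) (fun x => by ring) (fun x => by ring)
      (fun x => by rw [← sq_abs]; ring) hI1 (hI 3) hI2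
  have cs2 : (∫ x, |q x| ^ 3 * w x ∂μ) ^ 2 ≤ (∫ x, q x ^ 2 * w x ∂μ) * ∫ x, q x ^ 4 * w x ∂μ :=
    tightOfMoments_cauchySchwarz (fun x => |q x|) (fun x => q x ^ 2) w hw0
      (fun x => by rw [sq_abs]) (fun x => by ring) (fun x => by rw [← sq_abs]; ring) hI2 hI4 (hI 3)
  -- bookkeeping with `Z = ∫ w`, `A = ∫ |q| w`, `B = ∫ q² w`, `T = ∫ |q|³ w`, `K = ∫ q⁴ w`
  set Z := ∫ x, w x ∂μ with hZdef
  set A := ∫ x, |q x| * w x ∂μ with hAdef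
  set B := ∫ x, q x ^ 2 * w x ∂μ with hBdef
  set T := ∫ x, |q x| ^ 3 * w x ∂μ with hTdef
  set K := ∫ x, q x ^ 4 * w x ∂μ with hKdef
  have hA0 : 0 ≤ A := integral_nonneg fun x => mul_nonneg (abs_nonneg _) (hw0 x)
  have hK0 : 0 ≤ K := integral_nonneg fun x => mul_nonneg (by positivity) (hw0 x)
  -- `B⁴ ≤ A² T² ≤ A² B K`, so `B³ ≤ A² K`
  have h1 : B ^ 3 ≤ A ^ 2 * K := by
    have h4 : B ^ 4 ≤ A ^ 2 * (B * K) :=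
      calc B ^ 4 = (B ^ 2) ^ 2 := by ring
        _ ≤ (A * T) ^ 2 := pow_le_pow_left₀ (sq_nonneg _) cs1 2
        _ = A ^ 2 * T ^ 2 := by ring
        _ ≤ A ^ 2 * (B * K) := mul_le_mul_of_nonneg_left cs2 (sq_nonneg _)
    refine le_of_mul_le_mul_left ?_ hB
    calc B * B ^ 3 = B ^ 4 := by ring
      _ ≤ A ^ 2 * (B * K) := h4
      _ = B * (A ^ 2 * K) := by ring
  -- hence `K > 0`
  have hKpos : 0 < K := by
    rcases hK0.eq_or_lt with h | h
    · rw [← h, mul_zero] at h1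
      exact absurd h1 (not_le.mpr (pow_pos hB 3))
    · exact h
  -- `K Z² ≤ B³ ≤ A² K`, so `Z ≤ A`
  have h2 : Z ^ 2 ≤ A ^ 2 := by
    refine le_of_mul_le_mul_left ?_ hKpos
    calc K * Z ^ 2 ≤ B ^ 3 := hC
      _ ≤ A ^ 2 * K := h1
      _ = K * A ^ 2 := mul_comm _ _
  have h3 : Z ≤ A := (pow_le_pow_iff_left₀ hZ.le hA0 two_ne_zero).mp h2
  exact (one_le_div hZ).mpr h3

/-- **The Hölder `(3/2, 3)` step for a counting observable.** On a finite measure space, for a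
measurable bounded count `N`, a real offset `n₀` and a bounded a.e.-strongly measurable weight
`w ≥ 0`: `∫ w > 0`, `∫ (N − n₀)² w > 0` and `(∫ (N − n₀)⁴ w)(∫ w)² ≤ (∫ (N − n₀)² w)³` imply
`1 ≤ ∫ |N − n₀| w / ∫ w`. -/
theorem tightOfMoments_abstract {X : Type*} [MeasurableSpace X] {μ : Measure X}
    [IsFiniteMeasure μ] {N : X → ℕ} {w : X → ℝ} {C D : ℝ} (n₀ : ℝ) (hN : Measurable N)
    (hNC : ∀ x, (N x : ℝ) ≤ C) (hw : AEStronglyMeasurable w μ) (hwD : ∀ x, ‖w x‖ ≤ D)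
    (hw0 : ∀ x, 0 ≤ w x) (hZ : 0 < ∫ x, w x ∂μ)
    (hB : 0 < ∫ x, ((N x : ℝ) - n₀) ^ 2 * w x ∂μ)
    (hC : (∫ x, ((N x : ℝ) - n₀) ^ 4 * w x ∂μ) * (∫ x, w x ∂μ) ^ 2 ≤
      (∫ x, ((N x : ℝ) - n₀) ^ 2 * w x ∂μ) ^ 3) :
    1 ≤ (∫ x, |(N x : ℝ) - n₀| * w x ∂μ) / ∫ x, w x ∂μ := by
  -- the observable `q = N - n₀` is measurable and bounded by `C + |n₀|`
  have hqm : Measurable fun x => ((N x : ℝ) - n₀) := (measurable_from_nat.comp hN).sub_const n₀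
  have hqC : ∀ x, |(N x : ℝ) - n₀| ≤ C + |n₀| := fun x =>
    (abs_sub _ _).trans (add_le_add ((Nat.abs_cast _).trans_le (hNC x)) le_rfl)
  -- so every `|q|^j w` is integrable (bounded, a.e.-strongly measurable, finite measure)
  have hI : ∀ j : ℕ, Integrable (fun x => |(N x : ℝ) - n₀| ^ j * w x) μ := by
    intro j
    refine Integrable.of_bound
      (((continuous_abs.measurable.comp hqm).pow_const j).aestronglyMeasurable.mul hw)
      ((C + |n₀|) ^ j * D) (Eventually.of_forall fun x => ?_)
    rw [norm_mul, norm_pow, Real.norm_eq_abs, abs_abs]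
    exact mul_le_mul (pow_le_pow_left₀ (abs_nonneg _) (hqC x) j) (hwD x) (norm_nonneg _)
      (pow_nonneg ((abs_nonneg _).trans (hqC x)) j)
  exact tightOfMoments_core hw0 hI hZ hB hC

/-! ## The registered stub -/

/-- **STUB `stub_tightOfMoments` — TIGHT from two even moments (Hölder `(3/2, 3)` on the
phase-quenched functional).** On the torus of side `L` at coupling `β`, with weight
`w(U) = ∏_f |det D_W(U, mq_f, 1)|`, index-type observable
`q(U) = #{roots of charpoly(Γ₅ D_W(U, m₀, 1)) with Re < 0} − n₀` (any real offset `n₀`) and the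
Wilson measure `μ`: if `∫ w dμ > 0`, `∫ q² w dμ > 0` and `(∫ q⁴ w)(∫ w)² ≤ (∫ q² w)³`, then
`1 ≤ ∫ |q| w dμ / ∫ w dμ`.  Proof: Cauchy–Schwarz twice, `(∫q²w)² ≤ (∫|q|w)(∫|q|³w)` and
`(∫|q|³w)² ≤ (∫q²w)(∫q⁴w)`, hence `(∫q²w)³ ≤ (∫|q|w)² ∫q⁴w` (`tightOfMoments_abstract`); the
count is measurable (`stub_negCountMeasurable`) and bounded by the dimension, the weight is
continuous and bounded (`extinctOfDOS_weight`) and the Wilson measure is a probability measure,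
so all integrands `|q|^j w` are integrable.  Card `tight-from-two-moments`, First lemma. -/
theorem stub_tightOfMoments :
    ∀ (Nf L : ℕ) [NeZero L] (β m₀ n₀ : ℝ) (mq : Fin Nf → ℝ),
      0 < (∫ U, ∏ f : Fin Nf, ‖fermionDet (wilsonDirac (fundamentalRep (Fin 3)) U (mq f) 1)‖ ∂(wilsonMeasure (d := 4) (L := L) (fundamentalRep (Fin 3)) β)) →
      0 < (∫ U, ((Multiset.countP (fun z : ℂ => z.re < 0) (spinorLift gammaFive * wilsonDirac (fundamentalRep (Fin 3)) U m₀ 1).charpoly.roots : ℝ) - n₀) ^ 2 * ∏ f : Fin Nf, ‖fermionDet (wilsonDirac (fundamentalRep (Fin 3)) U (mq f) 1)‖ ∂(wilsonMeasure (d := 4) (L := L) (fundamentalRep (Fin 3)) β)) →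
      (∫ U, ((Multiset.countP (fun z : ℂ => z.re < 0) (spinorLift gammaFive * wilsonDirac (fundamentalRep (Fin 3)) U m₀ 1).charpoly.roots : ℝ) - n₀) ^ 4 * ∏ f : Fin Nf, ‖fermionDet (wilsonDirac (fundamentalRep (Fin 3)) U (mq f) 1)‖ ∂(wilsonMeasure (d := 4) (L := L) (fundamentalRep (Fin 3)) β))
          * (∫ U, ∏ f : Fin Nf, ‖fermionDet (wilsonDirac (fundamentalRep (Fin 3)) U (mq f) 1)‖ ∂(wilsonMeasure (d := 4) (L := L) (fundamentalRep (Fin 3)) β)) ^ 2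
        ≤ (∫ U, ((Multiset.countP (fun z : ℂ => z.re < 0) (spinorLift gammaFive * wilsonDirac (fundamentalRep (Fin 3)) U m₀ 1).charpoly.roots : ℝ) - n₀) ^ 2 * ∏ f : Fin Nf, ‖fermionDet (wilsonDirac (fundamentalRep (Fin 3)) U (mq f) 1)‖ ∂(wilsonMeasure (d := 4) (L := L) (fundamentalRep (Fin 3)) β)) ^ 3 →
      1 ≤ (∫ U, (|(Multiset.countP (fun z : ℂ => z.re < 0) (spinorLift gammaFive * wilsonDirac (fundamentalRep (Fin 3)) U m₀ 1).charpoly.roots : ℝ) - n₀|) * ∏ f : Fin Nf, ‖fermionDet (wilsonDirac (fundamentalRep (Fin 3)) U (mq f) 1)‖ ∂(wilsonMeasure (d := 4) (L := L) (fundamentalRep (Fin 3)) β))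
          / (∫ U, ∏ f : Fin Nf, ‖fermionDet (wilsonDirac (fundamentalRep (Fin 3)) U (mq f) 1)‖ ∂(wilsonMeasure (d := 4) (L := L) (fundamentalRep (Fin 3)) β)) := by
  intro Nf L _ β m₀ n₀ mq hZ hB hC
  haveI : IsProbabilityMeasure (wilsonMeasure (d := 4) (L := L) (fundamentalRep (Fin 3)) β) :=
    isProbabilityMeasure_wilsonMeasure _ (continuous_fundamentalRep (Fin 3)) β
  obtain ⟨hwc, D, hD⟩ := extinctOfDOS_weight (L := L) mq
  exact tightOfMoments_abstract n₀ (stub_negCountMeasurable L m₀)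
    (fun U => extinctOfDOS_countP_le _ _) hwc.aestronglyMeasurable hD
    (fun U => Finset.prod_nonneg fun f _ => norm_nonneg _) hZ hB hC

end Summit.QuantumFields.QCD.Cruxes.TipPricing.TightFromTwoMoments

end
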